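import Mathlib.Topology.Algebra.ClopenNhdofOne
import Mathlib.Topology.Algebra.OpenSubgroup
import Mathlib.GroupTheory.Subgroup.Centralizer
import Mathlib.GroupTheory.QuotientGroup.Defs
import Mathlib.Tactic.Group
import Mathlib.FieldTheory.Galois.Profinite
import Mathlib.FieldTheory.Normal.Closure
import HarnessLib

/-!
# Level-wise conjugacy in a compact group yields a global conjugator (the limit step of Neukirch–Uchida)

Topic `Literature/GroupTheory`; namespace `Literature.GroupTheory.LevelwiseConjugacyLimit`.  Proof-only,
classical, Mathlib-only (no `def`, no `instance`, no named fact).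

THE STATEMENT.  Let `G` be a compact topological group, `S ⊆ G` any subset and `σ : G → G` any map.  Let
`(N_i)_i` be a family of OPEN subgroups of `G`, directed under reverse inclusion and separating points
(`⋂ N_i = 1`).  If for every level `i` there is a "level-`i` conjugator" `τ_i ∈ G` with
`σ(h) ≡ τ_i h τ_i⁻¹ (mod N_i)` for all `h ∈ S`, then there is ONE `τ ∈ G` with `σ(h) = τ h τ⁻¹` for all `h ∈ S`
(`exists_forall_eq_conj_of_levelwise`).  If moreover the centraliser of `S` in `G` is trivial (e.g. `G` slim and
`S ⊇` an open subgroup), `τ` is unique (`existsUnique_forall_eq_conj_of_levelwise`).  For a profinite `G` the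
family of ALL open normal subgroups qualifies (`exists_forall_eq_conj_of_forall_openNormalSubgroup`).

PROOF.  The sets `C_i = {τ | ∀ h ∈ S, σ(h)⁻¹ τ h τ⁻¹ ∈ N_i}` are closed (an open subgroup is closed and
`τ ↦ σ(h)⁻¹ τ h τ⁻¹` is continuous), non-empty, and directed under `⊇`; by compactness (Cantor's intersection
theorem, `IsCompact.nonempty_iInter_of_directed_nonempty_isCompact_isClosed`) they have a common point `τ`, and
`σ(h)⁻¹ τ h τ⁻¹ ∈ ⋂ N_i = 1`.

USE.  This is the abstract form of the last step of the proof of the Neukirch–Uchida theorem ([NSW] Thm.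
(12.2.1)): once a topological isomorphism `σ : G_{K₁} ⥲ G_{K₂}` of absolute Galois groups of number fields is
known to be induced by conjugation at every finite Galois level `M/ℚ` (a non-empty finite set of candidate
conjugators in `Gal(M/ℚ)`), compactness of `G_ℚ` produces a global conjugator and slimness of `G_ℚ` makes it
unique.  Written for the abc-iut cell's GAP-LEDGER row G-L4d2g4-1 (abc-iut-L4-d2's «NU-DEDUCTION», brick B4,
abstract half); the number theory (existence of level-wise conjugators) is NOT here.  Classical; nothing in this
file bears on [IUTchIII] Cor. 3.12.

## References
* [RibesZalesskii2010] L. Ribes, P. Zalesskii, *Profinite Groups* (2nd ed.), Thm 2.1.3.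
* [NeukirchSchmidtWingberg2008] J. Neukirch, A. Schmidt, K. Wingberg, *Cohomology of Number Fields* (2nd ed.),
  Thm. (12.2.1) and its proof (passage to the limit over finite Galois levels).
-/

namespace Literature.GroupTheory.LevelwiseConjugacyLimit

open Topology

universe u v

/-! ### Pure group theory: uniqueness of a conjugator, and the trivial converse -/

section Algebra

variable {G : Type u} [Group G]

/-- If `σ` is conjugation by `τ` on `S`, then `σ` is conjugation by `τ` on `S` modulo EVERY subgroup `N`
(the trivial direction: a global conjugator is a level-wise conjugator at every level).
[cite: NeukirchSchmidtWingberg2008, Thm (12.2.1)] -/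
theorem levelwise_of_forall_eq_conj {S : Set G} {σ : G → G} {τ : G}
    (hτ : ∀ h ∈ S, σ h = τ * h * τ⁻¹) (N : Subgroup G) :
    ∀ h ∈ S, (σ h)⁻¹ * (τ * h * τ⁻¹) ∈ N := by
  intro h hh
  rw [hτ h hh, inv_mul_cancel]
  exact N.one_mem

/-- Two conjugators inducing the same map on `S` differ by an element of the centraliser of `S`:
if `τ h τ⁻¹ = τ' h τ'⁻¹` for all `h ∈ S` then `τ⁻¹ τ' ∈ Z_G(S)`. [cite: NeukirchSchmidtWingberg2008, Thm (12.2.1)] -/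
theorem inv_mul_mem_centralizer_of_forall_conj_eq {S : Set G} {τ τ' : G}
    (h : ∀ s ∈ S, τ * s * τ⁻¹ = τ' * s * τ'⁻¹) : τ⁻¹ * τ' ∈ Subgroup.centralizer S := by
  rw [Subgroup.mem_centralizer_iff]
  intro s hs
  have e := h s hs
  calc s * (τ⁻¹ * τ') = τ⁻¹ * (τ * s * τ⁻¹) * τ' := by group
    _ = τ⁻¹ * (τ' * s * τ'⁻¹) * τ' := by rw [e]
    _ = τ⁻¹ * τ' * s := by group

/-- **Uniqueness of the conjugator.**  If the centraliser of `S` in `G` is trivial, a map `σ` is conjugation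
on `S` by AT MOST ONE element of `G`.  (In the Neukirch–Uchida setting: `G = G_ℚ` is slim and `S = G_{K₁}` is
open, so `Z_G(S) = 1`.) [cite: NeukirchSchmidtWingberg2008, Thm (12.2.1)] -/
theorem conj_unique_of_centralizer_eq_bot {S : Set G} (hZ : Subgroup.centralizer S = ⊥) {σ : G → G}
    {τ τ' : G} (hτ : ∀ h ∈ S, σ h = τ * h * τ⁻¹) (hτ' : ∀ h ∈ S, σ h = τ' * h * τ'⁻¹) : τ = τ' := by
  have hmem : τ⁻¹ * τ' ∈ Subgroup.centralizer S :=
    inv_mul_mem_centralizer_of_forall_conj_eq fun s hs => (hτ s hs).symm.trans (hτ' s hs)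
  rw [hZ, Subgroup.mem_bot] at hmem
  exact inv_mul_eq_one.mp hmem

/-- Level-wise conjugacy in the coset spelling is the same as in the membership spelling:
`σ(h) ≡ τ h τ⁻¹ (mod N)` as an equality in `G ⧸ N` iff `σ(h)⁻¹ (τ h τ⁻¹) ∈ N` (private plumbing). [folklore] -/
private theorem mk_eq_mk_conj_iff (N : Subgroup G) (a τ h : G) :
    (QuotientGroup.mk a : G ⧸ N) = QuotientGroup.mk (τ * h * τ⁻¹) ↔ a⁻¹ * (τ * h * τ⁻¹) ∈ N :=
  QuotientGroup.eq

end Algebra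

/-! ### The compactness argument -/

section Topology

variable {G : Type u} [Group G] [TopologicalSpace G] [IsTopologicalGroup G]

/-- The set of level-`N` conjugators `{τ | ∀ h ∈ S, σ(h)⁻¹ τ h τ⁻¹ ∈ N}` is CLOSED when `N` is an open
(hence closed) subgroup: it is an intersection of preimages of `N` under the continuous maps
`τ ↦ σ(h)⁻¹ τ h τ⁻¹`. [cite: NeukirchSchmidtWingberg2008, Thm (12.2.1)] -/
theorem isClosed_setOf_levelwiseConj (N : Subgroup G) (hN : IsOpen (N : Set G)) (S : Set G) (σ : G → G) :
    IsClosed {τ : G | ∀ h ∈ S, (σ h)⁻¹ * (τ * h * τ⁻¹) ∈ N} := by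
  have hNc : IsClosed (N : Set G) := N.isClosed_of_isOpen hN
  have hset : {τ : G | ∀ h ∈ S, (σ h)⁻¹ * (τ * h * τ⁻¹) ∈ N} =
      ⋂ h ∈ S, (fun τ : G => (σ h)⁻¹ * (τ * h * τ⁻¹)) ⁻¹' (N : Set G) := by
    ext τ
    simp only [Set.mem_setOf_eq, Set.mem_iInter, Set.mem_preimage, SetLike.mem_coe]
  rw [hset]
  refine isClosed_biInter fun h _ => hNc.preimage ?_
  exact continuous_const.mul ((continuous_id.mul continuous_const).mul continuous_id.inv)

/-- **Level-wise conjugacy ⇒ a global conjugator** (the limit step of Neukirch–Uchida, abstract form).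
`G` a compact topological group; `N : ι → Subgroup G` a family of OPEN subgroups, directed under reverse
inclusion, separating points (`∀ x, (∀ i, x ∈ N i) → x = 1`); `S ⊆ G` any subset, `σ : G → G` any map.  If at
every level `i` some `τ` satisfies `σ(h)⁻¹ τ h τ⁻¹ ∈ N i` for all `h ∈ S`, then some `τ ∈ G` satisfies
`σ(h) = τ h τ⁻¹` for all `h ∈ S`.  Proof: Cantor intersection of the closed, non-empty, `⊇`-directed sets of
level-wise conjugators. [cite: NeukirchSchmidtWingberg2008, Thm (12.2.1)] -/
theorem exists_forall_eq_conj_of_levelwise [CompactSpace G] {ι : Type v} [Nonempty ι]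
    (N : ι → Subgroup G) (hopen : ∀ i, IsOpen (N i : Set G)) (hdir : Directed (· ≥ ·) N)
    (hsep : ∀ x : G, (∀ i, x ∈ N i) → x = 1) (S : Set G) (σ : G → G)
    (hlev : ∀ i, ∃ τ : G, ∀ h ∈ S, (σ h)⁻¹ * (τ * h * τ⁻¹) ∈ N i) :
    ∃ τ : G, ∀ h ∈ S, σ h = τ * h * τ⁻¹ := by
  let C : ι → Set G := fun i => {τ : G | ∀ h ∈ S, (σ h)⁻¹ * (τ * h * τ⁻¹) ∈ N i}
  have hCdir : Directed (· ⊇ ·) C := by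
    intro i j
    obtain ⟨k, hki, hkj⟩ := hdir i j
    exact ⟨k, fun τ hτ h hh => hki (hτ h hh), fun τ hτ h hh => hkj (hτ h hh)⟩
  have hCne : ∀ i, (C i).Nonempty := fun i => hlev i
  have hCcl : ∀ i, IsClosed (C i) := fun i => isClosed_setOf_levelwiseConj (N i) (hopen i) S σ
  obtain ⟨τ, hτ⟩ := IsCompact.nonempty_iInter_of_directed_nonempty_isCompact_isClosed C hCdir hCne
    (fun i => (hCcl i).isCompact) hCcl
  refine ⟨τ, fun h hh => ?_⟩
  have hmem : ∀ i, (σ h)⁻¹ * (τ * h * τ⁻¹) ∈ N i := fun i => (Set.mem_iInter.mp hτ i) h hh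
  exact inv_mul_eq_one.mp (hsep _ hmem)

/-- The same, as an EQUIVALENCE: `σ` is conjugation on `S` by some element of `G` iff it is so modulo every
member of a separating directed family of open subgroups. [cite: NeukirchSchmidtWingberg2008, Thm (12.2.1)] -/
theorem exists_forall_eq_conj_iff_levelwise [CompactSpace G] {ι : Type v} [Nonempty ι]
    (N : ι → Subgroup G) (hopen : ∀ i, IsOpen (N i : Set G)) (hdir : Directed (· ≥ ·) N)
    (hsep : ∀ x : G, (∀ i, x ∈ N i) → x = 1) (S : Set G) (σ : G → G) :
    (∃ τ : G, ∀ h ∈ S, σ h = τ * h * τ⁻¹) ↔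
      ∀ i, ∃ τ : G, ∀ h ∈ S, (σ h)⁻¹ * (τ * h * τ⁻¹) ∈ N i :=
  ⟨fun ⟨τ, hτ⟩ i => ⟨τ, levelwise_of_forall_eq_conj hτ (N i)⟩,
    exists_forall_eq_conj_of_levelwise N hopen hdir hsep S σ⟩

/-- **Level-wise conjugacy ⇒ a UNIQUE global conjugator**, when the centraliser of `S` in `G` is trivial
(slimness). [cite: NeukirchSchmidtWingberg2008, Thm (12.2.1)] -/
theorem existsUnique_forall_eq_conj_of_levelwise [CompactSpace G] {ι : Type v} [Nonempty ι]
    (N : ι → Subgroup G) (hopen : ∀ i, IsOpen (N i : Set G)) (hdir : Directed (· ≥ ·) N)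
    (hsep : ∀ x : G, (∀ i, x ∈ N i) → x = 1) (S : Set G) (hZ : Subgroup.centralizer S = ⊥) (σ : G → G)
    (hlev : ∀ i, ∃ τ : G, ∀ h ∈ S, (σ h)⁻¹ * (τ * h * τ⁻¹) ∈ N i) :
    ∃! τ : G, ∀ h ∈ S, σ h = τ * h * τ⁻¹ := by
  obtain ⟨τ, hτ⟩ := exists_forall_eq_conj_of_levelwise N hopen hdir hsep S σ hlev
  exact ⟨τ, hτ, fun τ' hτ' => conj_unique_of_centralizer_eq_bot hZ hτ' hτ⟩

/-- Coset spelling of the hypothesis: if at every level `i` some `τ` has `σ(h) = τ h τ⁻¹` IN `G ⧸ N i` for all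
`h ∈ S`, then a global conjugator exists. [cite: NeukirchSchmidtWingberg2008, Thm (12.2.1)] -/
theorem exists_forall_eq_conj_of_levelwise_mk [CompactSpace G] {ι : Type v} [Nonempty ι]
    (N : ι → Subgroup G) (hopen : ∀ i, IsOpen (N i : Set G)) (hdir : Directed (· ≥ ·) N)
    (hsep : ∀ x : G, (∀ i, x ∈ N i) → x = 1) (S : Set G) (σ : G → G)
    (hlev : ∀ i, ∃ τ : G, ∀ h ∈ S,
      (QuotientGroup.mk (σ h) : G ⧸ N i) = QuotientGroup.mk (τ * h * τ⁻¹)) :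
    ∃ τ : G, ∀ h ∈ S, σ h = τ * h * τ⁻¹ := by
  refine exists_forall_eq_conj_of_levelwise N hopen hdir hsep S σ fun i => ?_
  obtain ⟨τ, hτ⟩ := hlev i
  exact ⟨τ, fun h hh => (mk_eq_mk_conj_iff (N i) (σ h) τ h).mp (hτ h hh)⟩

/-- Subgroup spelling: `σ` given only on a subgroup `H` (as any map `H → G`, e.g. the composite of a
topological isomorphism `H ⥲ H'` with the inclusion `H' ≤ G`).  Level-wise conjugators at every level of a
separating directed family of open subgroups of the compact group `G` give a global conjugator:
`σ h = τ h τ⁻¹` for all `h : H`. [cite: NeukirchSchmidtWingberg2008, Thm (12.2.1)] -/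
theorem exists_forall_eq_conj_of_levelwise_subgroup [CompactSpace G] {ι : Type v} [Nonempty ι]
    (N : ι → Subgroup G) (hopen : ∀ i, IsOpen (N i : Set G)) (hdir : Directed (· ≥ ·) N)
    (hsep : ∀ x : G, (∀ i, x ∈ N i) → x = 1) (H : Subgroup G) (σ : H → G)
    (hlev : ∀ i, ∃ τ : G, ∀ h : H, (σ h)⁻¹ * (τ * h * τ⁻¹) ∈ N i) :
    ∃ τ : G, ∀ h : H, σ h = τ * h * τ⁻¹ := by
  classical
  -- extend `σ` by junk outside `H`
  let σ' : G → G := fun g => if hg : g ∈ H then σ ⟨g, hg⟩ else 1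
  have hσ' : ∀ h : H, σ' h = σ h := fun h => by
    simp only [σ', SetLike.coe_mem, dif_pos]
  obtain ⟨τ, hτ⟩ := exists_forall_eq_conj_of_levelwise N hopen hdir hsep (H : Set G) σ' fun i => by
    obtain ⟨τ, hτ⟩ := hlev i
    refine ⟨τ, fun g hg => ?_⟩
    have := hτ ⟨g, hg⟩
    rwa [← hσ' ⟨g, hg⟩] at this
  exact ⟨τ, fun h => by rw [← hσ' h]; exact hτ h h.2⟩

/-- Subgroup spelling with uniqueness: as `exists_forall_eq_conj_of_levelwise_subgroup`, and the conjugator is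
unique when `Z_G(H) = 1`. [cite: NeukirchSchmidtWingberg2008, Thm (12.2.1)] -/
theorem existsUnique_forall_eq_conj_of_levelwise_subgroup [CompactSpace G] {ι : Type v} [Nonempty ι]
    (N : ι → Subgroup G) (hopen : ∀ i, IsOpen (N i : Set G)) (hdir : Directed (· ≥ ·) N)
    (hsep : ∀ x : G, (∀ i, x ∈ N i) → x = 1) (H : Subgroup G)
    (hZ : Subgroup.centralizer (H : Set G) = ⊥) (σ : H → G)
    (hlev : ∀ i, ∃ τ : G, ∀ h : H, (σ h)⁻¹ * (τ * h * τ⁻¹) ∈ N i) :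
    ∃! τ : G, ∀ h : H, σ h = τ * h * τ⁻¹ := by
  obtain ⟨τ, hτ⟩ := exists_forall_eq_conj_of_levelwise_subgroup N hopen hdir hsep H σ hlev
  refine ⟨τ, hτ, fun τ' hτ' => ?_⟩
  have hmem : τ'⁻¹ * τ ∈ Subgroup.centralizer (H : Set G) :=
    inv_mul_mem_centralizer_of_forall_conj_eq fun s hs =>
      (hτ' ⟨s, hs⟩).symm.trans (hτ ⟨s, hs⟩)
  rw [hZ, Subgroup.mem_bot] at hmem
  exact inv_mul_eq_one.mp hmem

end Topology

/-! ### Profinite groups: the family of all open normal subgroups -/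

section Profinite

variable {G : Type u} [Group G] [TopologicalSpace G] [IsTopologicalGroup G] [CompactSpace G]
  [TotallyDisconnectedSpace G]

/-- In a profinite group the open normal subgroups SEPARATE POINTS: an element lying in every open normal
subgroup is trivial (open normal subgroups form a neighbourhood basis of `1` —
`ProfiniteGrp.exist_openNormalSubgroup_sub_open_nhds_of_one` — and points are closed; Ribes–Zalesskii,
*Profinite Groups*, Thm 2.1.3 (c): the open normal subgroups form a fundamental system of neighbourhoods of `1`
with trivial intersection). [cite: RibesZalesskii2010, Thm 2.1.3] -/
theorem eq_one_of_forall_mem_openNormalSubgroup [T2Space G] (x : G) (hx : ∀ N : OpenNormalSubgroup G, x ∈ N) :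
    x = 1 := by
  by_contra hne
  obtain ⟨N, hN⟩ := ProfiniteGrp.exist_openNormalSubgroup_sub_open_nhds_of_one
    (isOpen_compl_singleton (x := x)) (by simpa using fun h : (1 : G) = x => hne h.symm)
  exact hN (hx N) rfl

/-- **Level-wise conjugacy at every open normal subgroup of a profinite group ⇒ a global conjugator.**
`G` profinite (compact, Hausdorff, totally disconnected topological group), `S ⊆ G` any subset, `σ : G → G` any
map: if for every open normal `N ⊴ G` some `τ` has `σ(h)⁻¹ τ h τ⁻¹ ∈ N` for all `h ∈ S`, then some `τ ∈ G` has
`σ(h) = τ h τ⁻¹` for all `h ∈ S`. [cite: NeukirchSchmidtWingberg2008, Thm (12.2.1)] -/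
theorem exists_forall_eq_conj_of_forall_openNormalSubgroup [T2Space G] (S : Set G) (σ : G → G)
    (hlev : ∀ N : OpenNormalSubgroup G, ∃ τ : G, ∀ h ∈ S, (σ h)⁻¹ * (τ * h * τ⁻¹) ∈ N) :
    ∃ τ : G, ∀ h ∈ S, σ h = τ * h * τ⁻¹ := by
  haveI : Nonempty (OpenNormalSubgroup G) :=
    ⟨{ toOpenSubgroup := ⊤, isNormal' := by change (⊤ : Subgroup G).Normal; infer_instance }⟩
  refine exists_forall_eq_conj_of_levelwise (fun N : OpenNormalSubgroup G => (N : Subgroup G))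
    (fun N => N.isOpen) ?_ (fun x hx => eq_one_of_forall_mem_openNormalSubgroup x hx) S σ hlev
  intro N N'
  exact ⟨N ⊓ N', inf_le_left, inf_le_right⟩

/-- The profinite form with UNIQUENESS under a trivial centraliser (slimness).
[cite: NeukirchSchmidtWingberg2008, Thm (12.2.1)] -/
theorem existsUnique_forall_eq_conj_of_forall_openNormalSubgroup [T2Space G] (S : Set G)
    (hZ : Subgroup.centralizer S = ⊥) (σ : G → G)
    (hlev : ∀ N : OpenNormalSubgroup G, ∃ τ : G, ∀ h ∈ S, (σ h)⁻¹ * (τ * h * τ⁻¹) ∈ N) :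
    ∃! τ : G, ∀ h ∈ S, σ h = τ * h * τ⁻¹ := by
  obtain ⟨τ, hτ⟩ := exists_forall_eq_conj_of_forall_openNormalSubgroup S σ hlev
  exact ⟨τ, hτ, fun τ' hτ' => conj_unique_of_centralizer_eq_bot hZ hτ' hτ⟩

/-- The profinite form in the subgroup spelling: `σ : H → G` on a subgroup `H`, level-wise conjugators at every
open normal subgroup ⇒ a global conjugator. [cite: NeukirchSchmidtWingberg2008, Thm (12.2.1)] -/
theorem exists_forall_eq_conj_of_forall_openNormalSubgroup_subgroup [T2Space G] (H : Subgroup G) (σ : H → G)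
    (hlev : ∀ N : OpenNormalSubgroup G, ∃ τ : G, ∀ h : H, (σ h)⁻¹ * (τ * h * τ⁻¹) ∈ N) :
    ∃ τ : G, ∀ h : H, σ h = τ * h * τ⁻¹ := by
  haveI : Nonempty (OpenNormalSubgroup G) :=
    ⟨{ toOpenSubgroup := ⊤, isNormal' := by change (⊤ : Subgroup G).Normal; infer_instance }⟩
  refine exists_forall_eq_conj_of_levelwise_subgroup (fun N : OpenNormalSubgroup G => (N : Subgroup G))
    (fun N => N.isOpen) ?_ (fun x hx => eq_one_of_forall_mem_openNormalSubgroup x hx) H σ hlev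
  intro N N'
  exact ⟨N ⊓ N', inf_le_left, inf_le_right⟩

end Profinite


/-! ### Galois groups: levels = finite (Galois) subextensions -/

section Galois

open IntermediateField

variable {k : Type u} {K : Type v} [Field k] [Field K] [Algebra k K]

/-- An automorphism of an algebraic extension `K/k` fixing every finite subextension pointwise is the identity
(every element generates a finite subextension). [folklore] -/
private theorem algEquiv_eq_one_of_forall_mem_fixingSubgroup [Algebra.IsAlgebraic k K] (g : K ≃ₐ[k] K)
    (hg : ∀ E : IntermediateField k K, FiniteDimensional k E → g ∈ E.fixingSubgroup) : g = 1 := by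
  ext x
  have hx : FiniteDimensional k k⟮x⟯ :=
    adjoin.finiteDimensional (Algebra.IsAlgebraic.isAlgebraic x).isIntegral
  have h := (mem_fixingSubgroup_iff _ _).mp (hg k⟮x⟯ hx) x (mem_adjoin_simple_self k x)
  simpa using h

/-- **Galois-group form, levels = finite subextensions.**  `K/k` algebraic with `Gal(K/k)` compact (e.g. `K/k`
Galois, or `K = k̄`), `S ⊆ Gal(K/k)` any subset, `σ : Gal(K/k) → Gal(K/k)` any map.  If for every FINITE
subextension `E/k` of `K` some `τ ∈ Gal(K/k)` has `σ(h)` and `τ h τ⁻¹` AGREEING ON `E` for all `h ∈ S`, then some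
`τ` has `σ(h) = τ h τ⁻¹` for all `h ∈ S` (the levels are the open fixing subgroups `Gal(K/E)`, directed by
composita, separating since every element of `K` lies in a finite subextension).
[cite: NeukirchSchmidtWingberg2008, Thm (12.2.1)] -/
theorem exists_forall_eq_conj_of_forall_finiteDimensional [Algebra.IsAlgebraic k K]
    [CompactSpace (K ≃ₐ[k] K)] (S : Set (K ≃ₐ[k] K)) (σ : (K ≃ₐ[k] K) → (K ≃ₐ[k] K))
    (hlev : ∀ E : IntermediateField k K, FiniteDimensional k E →
      ∃ τ : K ≃ₐ[k] K, ∀ h ∈ S, ∀ x ∈ E, σ h x = (τ * h * τ⁻¹) x) :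
    ∃ τ : K ≃ₐ[k] K, ∀ h ∈ S, σ h = τ * h * τ⁻¹ := by
  let ι := {E : IntermediateField k K // FiniteDimensional k E}
  haveI : Nonempty ι := ⟨⟨⊥, inferInstance⟩⟩
  refine exists_forall_eq_conj_of_levelwise (G := K ≃ₐ[k] K) (fun E : ι => E.1.fixingSubgroup)
    (fun E => by haveI := E.2; exact E.1.fixingSubgroup_isOpen) ?_ ?_ S σ ?_
  · intro E E'
    haveI := E.2; haveI := E'.2
    exact ⟨⟨E.1 ⊔ E'.1, IntermediateField.finiteDimensional_sup E.1 E'.1⟩,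
      fixingSubgroup_antitone le_sup_left, fixingSubgroup_antitone le_sup_right⟩
  · intro g hg
    exact algEquiv_eq_one_of_forall_mem_fixingSubgroup g fun E hE => hg ⟨E, hE⟩
  · intro E
    obtain ⟨τ, hτ⟩ := hlev E.1 E.2
    refine ⟨τ, fun h hh => (mem_fixingSubgroup_iff _ _).mpr fun x hx => ?_⟩
    rw [AlgEquiv.mul_apply, ← hτ h hh x hx]
    simp

/-- **Galois-group form with uniqueness**: as `exists_forall_eq_conj_of_forall_finiteDimensional`, and the
conjugator is unique when the centraliser of `S` in `Gal(K/k)` is trivial (for `K = ℚ̄`, `S` an open subgroup: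
slimness of `G_ℚ`). [cite: NeukirchSchmidtWingberg2008, Thm (12.2.1)] -/
theorem existsUnique_forall_eq_conj_of_forall_finiteDimensional [Algebra.IsAlgebraic k K]
    [CompactSpace (K ≃ₐ[k] K)] (S : Set (K ≃ₐ[k] K)) (hZ : Subgroup.centralizer S = ⊥)
    (σ : (K ≃ₐ[k] K) → (K ≃ₐ[k] K))
    (hlev : ∀ E : IntermediateField k K, FiniteDimensional k E →
      ∃ τ : K ≃ₐ[k] K, ∀ h ∈ S, ∀ x ∈ E, σ h x = (τ * h * τ⁻¹) x) :
    ∃! τ : K ≃ₐ[k] K, ∀ h ∈ S, σ h = τ * h * τ⁻¹ := by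
  obtain ⟨τ, hτ⟩ := exists_forall_eq_conj_of_forall_finiteDimensional S σ hlev
  exact ⟨τ, hτ, fun τ' hτ' => conj_unique_of_centralizer_eq_bot hZ hτ' hτ⟩

/-- **Galois-group form, levels = finite GALOIS subextensions** (the shape of the Neukirch–Uchida proof: one
works at the finite Galois levels `M/k`).  `K/k` Galois, `S ⊆ Gal(K/k)`, `σ : Gal(K/k) → Gal(K/k)`: if for every
finite Galois subextension `M/k` of `K` some `τ` has `σ(h)|_M = (τ h τ⁻¹)|_M` for all `h ∈ S`, then some `τ` has
`σ(h) = τ h τ⁻¹` for all `h ∈ S` (finite Galois levels are cofinal: pass to the normal closure).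
[cite: NeukirchSchmidtWingberg2008, Thm (12.2.1)] -/
theorem exists_forall_eq_conj_of_forall_isGalois [IsGalois k K] (S : Set (K ≃ₐ[k] K))
    (σ : (K ≃ₐ[k] K) → (K ≃ₐ[k] K))
    (hlev : ∀ M : IntermediateField k K, FiniteDimensional k M → IsGalois k M →
      ∃ τ : K ≃ₐ[k] K, ∀ h ∈ S, ∀ x ∈ M, σ h x = (τ * h * τ⁻¹) x) :
    ∃ τ : K ≃ₐ[k] K, ∀ h ∈ S, σ h = τ * h * τ⁻¹ := by
  refine exists_forall_eq_conj_of_forall_finiteDimensional S σ fun E hE => ?_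
  -- pass to the normal closure `M` of `E` in `K`: finite and Galois over `k`, containing `E`
  let M : IntermediateField k K := normalClosure k E K
  haveI : FiniteDimensional k M := normalClosure.is_finiteDimensional k E K
  haveI : Normal k M := normalClosure.normal k E K
  haveI : Algebra.IsSeparable k M := inferInstance
  have hM : IsGalois k M := ⟨⟩
  obtain ⟨τ, hτ⟩ := hlev M inferInstance hM
  exact ⟨τ, fun h hh x hx => hτ h hh x (le_normalClosure E hx)⟩

/-- The finite-Galois-levels form with UNIQUENESS under a trivial centraliser.
[cite: NeukirchSchmidtWingberg2008, Thm (12.2.1)] -/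
theorem existsUnique_forall_eq_conj_of_forall_isGalois [IsGalois k K] (S : Set (K ≃ₐ[k] K))
    (hZ : Subgroup.centralizer S = ⊥) (σ : (K ≃ₐ[k] K) → (K ≃ₐ[k] K))
    (hlev : ∀ M : IntermediateField k K, FiniteDimensional k M → IsGalois k M →
      ∃ τ : K ≃ₐ[k] K, ∀ h ∈ S, ∀ x ∈ M, σ h x = (τ * h * τ⁻¹) x) :
    ∃! τ : K ≃ₐ[k] K, ∀ h ∈ S, σ h = τ * h * τ⁻¹ := by
  obtain ⟨τ, hτ⟩ := exists_forall_eq_conj_of_forall_isGalois S σ hlev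
  exact ⟨τ, hτ, fun τ' hτ' => conj_unique_of_centralizer_eq_bot hZ hτ' hτ⟩

end Galois

end Literature.GroupTheory.LevelwiseConjugacyLimit
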